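import Summits.AtomisticToContinuum.Crystallization.Theorems.FreeSplittingCertificatesStrictSplittingRuleCoreDefsStar
import Summits.AtomisticToContinuum.Crystallization.Theorems.FreeSplittingCertificatesStrictSplittingRuleCoreFirstOrderDesignGeometry
import Summits.AtomisticToContinuum.Crystallization.Theorems.FreeSplittingCertificatesStrictSplittingRuleCoreHall

/-!
# The prestress form vanishes on linear images of the relaxed hcp lattice

Helper of reshape r5 (lead c5) of crux `StrictSplittingRule` (stmt-AtomisticToContinuum-12560), line `registered`.
Registered stub, landed `--supports stmt-AtomisticToContinuum-12560`.
-/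

noncomputable section

namespace Summit.AtomisticToContinuum.Crystallization.Theorems.StrictSplittingRuleBirth

open scoped BigOperators Classical
open Literature.MathematicalPhysics.StatisticalMechanics
open Literature.Geometry.DiscreteGeometry
open Summit.AtomisticToContinuum.Crystallization.Theorems.PalmUnimodularRigidity.LayeredLawsSelectHcp
  (hcpSite ljSqDeriv)

/-- **stub_prestressFormVanishes** (r5 helper, far field F2): at the hcp-family minimiser the static prestress does no
work on ANY linear image of the lattice: `Σ_d W′(‖y_d‖²)‖G y_d‖² = 0` for every linear `G` (in particular for skew `G` =
linearised rotations), with summability — `‖G y‖² = Σ_l ⟨Gᵀe_l, y⟩²`, `h1_stressForm`, and zero site stress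
`core_zeroStress`. [folklore] -/
theorem stub_prestressFormVanishes : ∀ a h : ℝ, 0 < a → 0 < h → HcpFamilyMin a h →
    ∀ G : EuclideanSpace ℝ (Fin 3) →ₗ[ℝ] EuclideanSpace ℝ (Fin 3),
      (Summable fun d : ℤ × ℤ × ℤ => ljSqDeriv (‖hcpSite a h d‖ ^ 2) * ‖G (hcpSite a h d)‖ ^ 2) ∧
      ∑' d : ℤ × ℤ × ℤ, ljSqDeriv (‖hcpSite a h d‖ ^ 2) * ‖G (hcpSite a h d)‖ ^ 2 = 0 := by
  intro a h ha hh hfam G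
  have hS := core_zeroStress ha hh hfam
  -- the rows of `G` as vectors: `(G y) l = ⟪y, x l⟫`, `x l = Gᵀ e_l`
  set x : Fin 3 → EuclideanSpace ℝ (Fin 3) :=
    fun l => LinearMap.adjoint G (EuclideanSpace.single l (1 : ℝ)) with hx
  have hrow : ∀ (y : EuclideanSpace ℝ (Fin 3)) (l : Fin 3), (G y) l = inner ℝ y (x l) := fun y l => by
    simp [hx, LinearMap.adjoint_inner_right, EuclideanSpace.inner_single_right]
  have hnorm : ∀ y : EuclideanSpace ℝ (Fin 3), ‖G y‖ ^ 2 = ∑ l : Fin 3, inner ℝ y (x l) ^ 2 := fun y => by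
    rw [EuclideanSpace.real_norm_sq_eq]
    exact Finset.sum_congr rfl fun l _ => by rw [hrow]
  have hterm : ∀ d : ℤ × ℤ × ℤ, ljSqDeriv (‖hcpSite a h d‖ ^ 2) * ‖G (hcpSite a h d)‖ ^ 2 =
      ∑ l : Fin 3, ljSqDeriv (‖hcpSite a h d‖ ^ 2) * inner ℝ (hcpSite a h d) (x l) ^ 2 := fun d => by
    rw [hnorm, Finset.mul_sum]
  simp_rw [hterm]
  refine ⟨summable_sum fun l _ => (h1_stressForm ha.ne' hh.ne' (x l)).1, ?_⟩
  rw [Summable.tsum_finsetSum fun l _ => (h1_stressForm ha.ne' hh.ne' (x l)).1]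
  refine Finset.sum_eq_zero fun l _ => ?_
  rw [(h1_stressForm ha.ne' hh.ne' (x l)).2]
  simp [hS]

end Summit.AtomisticToContinuum.Crystallization.Theorems.StrictSplittingRuleBirth

end
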